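import Summits.HodgeConjecture.HodgeConjecture.Theorems.Ring2HypothesesDescentMotivatedTraceFormula
import HarnessLib

/-!
# Ring 2 hypotheses, descent face — THE LEFSCHETZ TRACE FORMULA FOR CORRESPONDENCE CLASSES on the real carriers, II:
# `Σₐ (-1)ᵃ Tr([w]_* ∘ [u]_* | Hᵃ(X(ℂ))) · 1 = p₁₊ p₂^* p₁₊ (u ∪ σ^* w)` for all `u, w`, non-degeneracy of the reading
# `t ↦ p₁₊ p₂^* p₁₊ t` of top classes, and faithfulness of the total action of a class of codimension `n = dim X`

research route conditional on HC_CM; not a corollary; Q11.4-sentence-2 already refuted in dim ≥ 3.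
Cell `pub-hodge-ring2` (Hodge ladder STAGE 3), seat `ring2-b05` (binder row b05
`Ring2.Hypotheses.MotivatedImpliesAlgebraicAV`), gen 37. `HC_CM` (`Theses.RankFourFaces.CMAbelianHodge`) does
not occur in this file; nothing here proves a case of the Hodge conjecture; the row b05 stays OPEN.

Sequel of `…MotivatedTraceFormula` (Kleiman 1968, Prop. 1.3.6 «`⟨u · ᵗw⟩ = Σ (-1)ⁱ Tr(w ∘ u | Hⁱ(X))`»; André 1996,
proof of Prop. 3.1, p. 20, «la formule de trace»), for `X` smooth projective of dimension `n`, any orientation family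
`μ`, `[u]_* = corrAction μ hX hX rfl u : Hᵃ(X(ℂ); ℂ) → Hᵃ(X(ℂ); ℂ)` for `u ∈ H²ⁿ((X ⊗ X)(ℂ); ℂ)`:

* §1 **`gradedTrace_corrAction_comp_smul_one`** — THE TRACE FORMULA for all `u, w ∈ H²ⁿ((X ⊗ X)(ℂ))`:
  `(Σ_{a ≤ 2n} (-1)ᵃ Tr([w]_* ∘ [u]_* |Hᵃ)) · 1_X = p₁₊ p₂^* p₁₊ (u ∪ σ^* w)` (`σ^* w = ᵗw` the transpose); both sides
  are bilinear and agree on cross products (`gradedTrace_corrAction_comp_cross`), which span (Künneth).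
* §2 `exists_fibreIntegral_ne_zero` (`p₁₊ p₂^* ≠ 0` on `H²ⁿ(X(ℂ))`: `[Δ]_* = id ≠ 0` on `H⁰ ∋ 1_X ≠ 0`),
  `eq_zero_of_fibreIntegral_fst_eq_zero` (the reading `t ↦ p₁₊ p₂^* p₁₊ t` is injective on the line
  `H⁴ⁿ((X ⊗ X)(ℂ))`), **`eq_zero_of_forall_corrAction_eq_zero`** — a class `u ∈ H²ⁿ((X ⊗ X)(ℂ))` all of whose
  actions `[u]_* : Hᵃ → Hᵃ`, `a ≤ 2n`, vanish is zero (faithfulness of the total action; Poincaré duality on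
  `(X ⊗ X)(ℂ)`, ab-andre-2's `Ring2.AbelianAll.eq_zero_of_forall_cupProduct_eq_zero`).

Consumer: `…MotivatedSemisimple` (André Prop. 3.1 / 3.3: nil ideals of motivated correspondences are numerically
trivial, hence zero; `C⁰_mot(X, X)_ℂ` is semisimple). No definition, no named fact, no sorry.
References: Kleiman1968AlgebraicCycles (§1.3 Prop. 1.3.6), Andre1996Motifs (Prop. 3.1 p. 20), FultonYoungTableaux1997
(App. B (5)–(6)), HatcherAT2002 (§3.2 Thm. 3.16, §3.3 Thm. 3.26, 3.30, Prop. 3.38).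
-/

noncomputable section

-- every declaration of this problem lives in `Summit.HodgeConjecture.HodgeConjecture.…` (summit = sub-problem)
set_option linter.dupNamespace false

open CategoryTheory AlgebraicGeometry MonoidalCategory CartesianMonoidalCategory
open Literature.AlgebraicTopology.SingularHomology Literature.Geometry.Kaehler
open Literature.AlgebraicGeometry Literature.AlgebraicGeometry.Motives
  Literature.AlgebraicGeometry.HodgeTheory

namespace Summit.HodgeConjecture.HodgeConjecture.Theorems

variable (μ : OrientationFamily) {n : ℕ} {X : SchemeOver ℂ}

/-! ## §1 The trace formula for all classes -/

/-- **THE LEFSCHETZ TRACE FORMULA FOR CORRESPONDENCE CLASSES on the real carriers** (Kleiman 1968, Prop. 1.3.6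
«`⟨u · ᵗw⟩ = Σᵢ (-1)ⁱ Tr(w ∘ u | Hⁱ(X))`»; André 1996, proof of Prop. 3.1 «la formule de trace»). For `X` smooth
projective of dimension `n`, any orientation family `μ`, and `u, w ∈ H²ⁿ((X ⊗ X)(ℂ); ℂ)` acting as
`[u]_*, [w]_* : Hᵃ(X(ℂ)) → Hᵃ(X(ℂ))` (`corrAction`):
`(Σ_{a ≤ 2n} (-1)ᵃ Tr([w]_* ∘ [u]_* | Hᵃ)) · 1_X = p₁₊ p₂^* p₁₊ (u ∪ σ^* w)`, where `σ^* w` (pull-back along the swap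
`β_ X X`) is the transpose `ᵗw` and `t ↦ p₁₊ p₂^* p₁₊ t` is the (injective, §2) degree-`0` reading of the top class
`u ∪ σ^* w ∈ H⁴ⁿ((X ⊗ X)(ℂ))`. Both sides are bilinear; Künneth spanning in `u` and in `w` reduces to
`gradedTrace_corrAction_comp_cross`. [cite: Kleiman1968AlgebraicCycles, §1.3 Prop. 1.3.6]
[cite: Andre1996Motifs, proof of Prop. 3.1 (p. 20)] [cite: HatcherAT2002, §3.2 Thm. 3.16] -/
theorem gradedTrace_corrAction_comp_smul_one (hX : IsSmoothProjective n X) (u w : complexBetti (X ⊗ X) (2 * n)) :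
    (∑ a ∈ Finset.range (2 * n + 1), (-1 : ℂ) ^ a * LinearMap.trace ℂ _
        (corrAction μ hX hX (rfl : a + 2 * n = a + 2 * n) w ∘ₗ corrAction μ hX hX (rfl : a + 2 * n = a + 2 * n) u)) •
        singularCohomology.one ℂ (ComplexPoints X) =
      complexGysin μ (IsSmoothProjective.tensor_holds hX hX) hX (fst X X)
        (show 2 * n + 2 * n = 0 + 2 * (n + n) by omega)
        (complexBetti.map (snd X X) (2 * n)
          (complexGysin μ (IsSmoothProjective.tensor_holds hX hX) hX (fst X X)
            (show 2 * (n + n) + 2 * n = 2 * n + 2 * (n + n) by omega)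
            (cupProduct (show 2 * n + 2 * n = 2 * (n + n) by omega) u
              (complexBetti.map (β_ X X).hom (2 * n) w)))) := by
  have hXX := IsSmoothProjective.tensor_holds hX hX
  obtain ⟨φ, hφ⟩ := exists_fibreIntegral μ hX
  -- the two sides as bilinear maps in `(u, w)`
  let V := complexBetti (X ⊗ X) (2 * n)
  let L : (a : ℕ) → V →ₗ[ℂ] V →ₗ[ℂ] complexBetti X 0 := fun a ↦
    (((LinearMap.llcomp ℂ (complexBetti X a) (complexBetti X a) (complexBetti X a)).flip ∘ₗ
        corrAction μ hX hX (rfl : a + 2 * n = a + 2 * n)).compl₂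
      (corrAction μ hX hX (rfl : a + 2 * n = a + 2 * n))).compr₂
      (((-1 : ℂ) ^ a • LinearMap.trace ℂ (complexBetti X a)).smulRight (singularCohomology.one ℂ (ComplexPoints X)))
  let G : V →ₗ[ℂ] V →ₗ[ℂ] complexBetti X 0 := ∑ a ∈ Finset.range (2 * n + 1), L a
  let F : V →ₗ[ℂ] V →ₗ[ℂ] complexBetti X 0 :=
    ((cupProduct (show 2 * n + 2 * n = 2 * (n + n) by omega)).compl₂
      (complexBetti.map (β_ X X).hom (2 * n)).hom).compr₂
      (complexGysin μ hXX hX (fst X X) (show 2 * n + 2 * n = 0 + 2 * (n + n) by omega) ∘ₗ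
        (complexBetti.map (snd X X) (2 * n)).hom ∘ₗ
        complexGysin μ hXX hX (fst X X) (show 2 * (n + n) + 2 * n = 2 * n + 2 * (n + n) by omega))
  have hG : ∀ u' w' : V, G u' w' = (∑ a ∈ Finset.range (2 * n + 1), (-1 : ℂ) ^ a * LinearMap.trace ℂ _
      (corrAction μ hX hX (rfl : a + 2 * n = a + 2 * n) w' ∘ₗ corrAction μ hX hX (rfl : a + 2 * n = a + 2 * n) u')) •
        singularCohomology.one ℂ (ComplexPoints X) := fun u' w' ↦ by
    simp only [G, L, LinearMap.coe_sum, Finset.sum_apply, LinearMap.compr₂_apply, LinearMap.compl₂_apply,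
      LinearMap.comp_apply, LinearMap.flip_apply, LinearMap.llcomp_apply', LinearMap.smulRight_apply,
      LinearMap.smul_apply, smul_eq_mul, Finset.sum_smul]
  have hF : ∀ u' w' : V, F u' w' = complexGysin μ hXX hX (fst X X) (show 2 * n + 2 * n = 0 + 2 * (n + n) by omega)
      (complexBetti.map (snd X X) (2 * n) (complexGysin μ hXX hX (fst X X)
        (show 2 * (n + n) + 2 * n = 2 * n + 2 * (n + n) by omega)
        (cupProduct (show 2 * n + 2 * n = 2 * (n + n) by omega) u' (complexBetti.map (β_ X X).hom (2 * n) w')))) :=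
    fun u' w' ↦ by
    simp only [F, LinearMap.compr₂_apply, LinearMap.compl₂_apply, LinearMap.comp_apply]
  rw [← hG, ← hF]
  -- Step A: for a cross product `w'` and every `u'` (linearity in `u'`)
  have stepA : ∀ {i' j' : ℕ} (hij' : i' + j' = 2 * n) (x' : complexBetti X i') (y' : complexBetti X j') (u' : V),
      G u' (cupProduct hij' (complexBetti.map (fst X X) i' x') (complexBetti.map (snd X X) j' y')) =
        F u' (cupProduct hij' (complexBetti.map (fst X X) i' x') (complexBetti.map (snd X X) j' y')) := by
    intro i' j' hij' x' y' u'
    have h := LinearMap.eqOn_span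
      (f := G.flip (cupProduct hij' (complexBetti.map (fst X X) i' x') (complexBetti.map (snd X X) j' y')))
      (g := F.flip (cupProduct hij' (complexBetti.map (fst X X) i' x') (complexBetti.map (snd X X) j' y')))
      ?_ (kunnethSpan_complexBetti hX hX (2 * n) u')
    · simpa only [LinearMap.flip_apply] using h
    · rintro _ ⟨i, j, hij, x, y, rfl⟩
      simp only [LinearMap.flip_apply]
      rw [hG, hF]
      exact gradedTrace_corrAction_comp_cross μ hX hφ hij hij' x y x' y'
  -- Step B: linearity in `w`
  refine LinearMap.eqOn_span (f := G u) (g := F u) ?_ (kunnethSpan_complexBetti hX hX (2 * n) w)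
  rintro _ ⟨i', j', hij', x', y', rfl⟩
  exact stepA hij' x' y' u

/-! ## §2 Non-degeneracy of the right-hand side and faithfulness of the total action -/

/-- **The fibre integral is not zero**: `p₁₊ p₂^* w₀ ≠ 0` for some `w₀ ∈ H²ⁿ(X(ℂ))`. Indeed `[Δ]_* = id ≠ 0` on
`H⁰(X(ℂ)) ∋ 1_X ≠ 0`, while by Künneth `[Δ]` is a combination of cross products `p₁^* x ∪ p₂^* y`, each acting on `H⁰`
as `0` (`deg x ≠ 0`) or as `c ↦ x ∪ p₁₊ p₂^*(c ∪ y)` (`deg x = 0`), which all vanish if `p₁₊ p₂^* = 0` on `H²ⁿ`.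
[cite: Kleiman1968AlgebraicCycles, §1.3 Prop. 1.3.6] [cite: HatcherAT2002, §3.3 Thm. 3.26] -/
theorem exists_fibreIntegral_ne_zero (hX : IsSmoothProjective n X) :
    ∃ w₀ : complexBetti X (2 * n),
      complexGysin μ (IsSmoothProjective.tensor_holds hX hX) hX (fst X X)
          (show 2 * n + 2 * n = 0 + 2 * (n + n) by omega) (complexBetti.map (snd X X) (2 * n) w₀) ≠ 0 := by
  have hXX := IsSmoothProjective.tensor_holds hX hX
  by_contra hall
  push Not at hall
  -- then every class of `H²ⁿ((X ⊗ X)(ℂ))` acts as `0` on `H⁰(X(ℂ))`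
  have hzero : ∀ v : complexBetti (X ⊗ X) (2 * n), corrAction μ hX hX (rfl : 0 + 2 * n = 0 + 2 * n) v = 0 := by
    intro v
    have hv := kunnethSpan_complexBetti hX hX (2 * n) v
    refine LinearMap.eqOn_span (f := corrAction μ hX hX (rfl : 0 + 2 * n = 0 + 2 * n)) (g := 0) ?_ hv
    rintro _ ⟨i, j, hij, x, y, rfl⟩
    rw [LinearMap.zero_apply]
    by_cases hi : 0 = i
    · subst hi
      refine LinearMap.ext fun c ↦ ?_
      rw [corrAction_cross_apply_self μ hX hij x y c, hall, map_zero, smul_zero, LinearMap.zero_apply]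
    · exact corrAction_cross_eq_zero_of_ne μ hX hij hi x y
  have hδ := (corrAction_diagonalClass μ hX 0).2
  rw [hzero] at hδ
  exact complexBetti_one_ne_zero hX (by simpa using (LinearMap.congr_fun hδ (singularCohomology.one ℂ (ComplexPoints X))).symm)

/-- **The reading `t ↦ p₁₊ p₂^* p₁₊ t` of top classes of `(X ⊗ X)(ℂ)` is injective**: `H⁴ⁿ((X ⊗ X)(ℂ); ℂ)` is a line
(`exists_eq_smul_of_top`) containing `t₀ = p₁^* w₀ ∪ p₂^* w₀` with `p₁₊ p₂^* p₁₊ t₀ = φ(w₀)² · 1_X ≠ 0`.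
[cite: HatcherAT2002, §3.3 Thm. 3.26 and Thm. 3.30] [cite: FultonYoungTableaux1997, Appendix B §B.1 (6)] -/
theorem eq_zero_of_fibreIntegral_fst_eq_zero (hX : IsSmoothProjective n X) {t : complexBetti (X ⊗ X) (2 * (n + n))}
    (ht : complexGysin μ (IsSmoothProjective.tensor_holds hX hX) hX (fst X X)
        (show 2 * n + 2 * n = 0 + 2 * (n + n) by omega)
        (complexBetti.map (snd X X) (2 * n)
          (complexGysin μ (IsSmoothProjective.tensor_holds hX hX) hX (fst X X)
            (show 2 * (n + n) + 2 * n = 2 * n + 2 * (n + n) by omega) t)) = 0) :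
    t = 0 := by
  have hμ : μ.HasPoincareDuality := OrientationFamily.hasPoincareDuality μ
  have hXX := IsSmoothProjective.tensor_holds hX hX
  obtain ⟨φ, hφ⟩ := exists_fibreIntegral μ hX
  obtain ⟨w₀, hw₀⟩ := exists_fibreIntegral_ne_zero μ hX
  have hφ₀ : φ w₀ ≠ 0 := by
    intro h0
    exact hw₀ (by rw [hφ, h0, zero_smul])
  -- the test class `t₀ = p₁^* w₀ ∪ p₂^* w₀`
  set t₀ : complexBetti (X ⊗ X) (2 * (n + n)) := cupProduct (show 2 * n + 2 * n = 2 * (n + n) by omega)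
    (complexBetti.map (fst X X) (2 * n) w₀) (complexBetti.map (snd X X) (2 * n) w₀) with ht₀def
  have hread : ∀ s : ℂ, complexGysin μ hXX hX (fst X X) (show 2 * n + 2 * n = 0 + 2 * (n + n) by omega)
      (complexBetti.map (snd X X) (2 * n) (complexGysin μ hXX hX (fst X X)
        (show 2 * (n + n) + 2 * n = 2 * n + 2 * (n + n) by omega) (s • t₀))) =
      (s * (φ w₀ * φ w₀)) • singularCohomology.one ℂ (ComplexPoints X) := by
    intro s
    rw [map_smul, ht₀def, complexGysin_cup hμ hXX hX (fst X X) (show 2 * n + 2 * n = 2 * (n + n) by omega) _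
        (show 2 * n + 2 * n = 0 + 2 * (n + n) by omega) (Nat.add_zero (2 * n)) w₀,
      hφ, map_smul, hφ, map_smul, cupProduct_one, map_smul, smul_eq_mul, smul_eq_mul]
  have ht₀ : t₀ ≠ 0 := by
    intro h0
    have h := hread 1
    rw [one_smul, h0, map_zero, map_zero, map_zero, one_mul] at h
    exact (mul_ne_zero hφ₀ hφ₀) ((smul_eq_zero.mp h.symm).resolve_right (complexBetti_one_ne_zero hX))
  obtain ⟨s, rfl⟩ := exists_eq_smul_of_top μ hXX ht₀ t
  rw [hread] at ht
  rcases smul_eq_zero.mp ht with hs | h1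
  · rcases mul_eq_zero.mp hs with hs | hφφ
    · rw [hs, zero_smul]
    · exact absurd hφφ (mul_ne_zero hφ₀ hφ₀)
  · exact absurd h1 (complexBetti_one_ne_zero hX)

/-- **Faithfulness of the total action of a class of codimension `n`**: if `u ∈ H²ⁿ((X ⊗ X)(ℂ); ℂ)` acts as `0` on
every `Hᵃ(X(ℂ); ℂ)`, `a ≤ 2n`, then `u = 0`. By the trace formula `p₁₊ p₂^* p₁₊ (u ∪ σ^* w) = 0` for every `w`, so
`u ∪ v = 0` for every top-complementary `v = σ^* (σ^* v)` (§2), and `u = 0` by Poincaré duality on `(X ⊗ X)(ℂ)`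
(`Ring2.AbelianAll.eq_zero_of_forall_cupProduct_eq_zero`). [cite: Kleiman1968AlgebraicCycles, §1.3 Prop. 1.3.6]
[cite: HatcherAT2002, §3.3 Thm. 3.30 and Prop. 3.38] -/
theorem eq_zero_of_forall_corrAction_eq_zero (hX : IsSmoothProjective n X) {u : complexBetti (X ⊗ X) (2 * n)}
    (hu : ∀ a ≤ 2 * n, corrAction μ hX hX (rfl : a + 2 * n = a + 2 * n) u = 0) : u = 0 := by
  have hXX := IsSmoothProjective.tensor_holds hX hX
  refine Ring2.AbelianAll.eq_zero_of_forall_cupProduct_eq_zero hXX (show 2 * n + 2 * n = 2 * (n + n) by omega)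
    fun v ↦ ?_
  -- `v = σ^* (σ^* v)`
  have hv : v = complexBetti.map (β_ X X).hom (2 * n) (complexBetti.map (β_ X X).hom (2 * n) v) := by
    rw [← complexBetti.map_comp_apply', SymmetricCategory.symmetry, complexBetti.map_id]
    rfl
  rw [hv]
  refine eq_zero_of_fibreIntegral_fst_eq_zero μ hX ?_
  rw [← gradedTrace_corrAction_comp_smul_one μ hX u, Finset.sum_eq_zero, zero_smul]
  intro a ha
  rw [hu a (by simpa [Nat.lt_succ_iff] using Finset.mem_range.mp ha), LinearMap.comp_zero, map_zero, mul_zero]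

end Summit.HodgeConjecture.HodgeConjecture.Theorems

end
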